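import Summits.QuantumFields.BalabanUV.T4Continuum.Spine.NE9.DirectPairingApexEffective
import Mathlib.Analysis.SpecialFunctions.Log.Deriv
import Mathlib.Analysis.Complex.Exponential

/-!
# T⁴ programme, spine estimate NE9 — THE RATE AT THE APEX, SYMMETRIC CURRENCY BY NAME: the cumulant generating function of a bounded observable obeys the
# third-order symmetric bound, so the Wilson-loop expectations inherit the exponent `2∕3` (not only `1∕2`) of the King route's generating-function rate —
# census item C45 (b) of cell `pub-balaban-gaps`, seat ne9 (gen 14)

Cell `pub-balaban-gaps` (YM blitz G2, seat ne9, unit `pub-balaban-gaps-ne9-g14`; record `run/shared/lean/pub/pub-balaban-gaps/ne/NE9.md` §5 row C45).  Sequel to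
`DirectPairingApexEffective` (C45 (a)): there §3 typed the SYMMETRIC currency at MODEL level only («for a cumulant generating function `M` is a third-cumulant bound
of the tilted laws — free for bounded observables, NOT typed here»).  This file discharges that clause for every observable bounded by `1` and carries the
exponent `2∕3` down to `Missing.TorusScheme.expectAt` BY NAME.  NO definition; nothing of Bałaban's asserted; elementary real analysis (Taylor bounds of `exp`
and `log` from Mathlib: `Real.exp_bound`, `Real.abs_log_sub_add_sum_range_le`) plus the tree's dictionary (`T4GenFunBounds.genFun_schemeZ_eq_cgf` ∕
`expectAt_eq_integral_gibbs`).
* §1 `abs_cgf_symm_sub_le`: for a probability measure and `∣X∣ ≤ 1` a.e., `0 < h ≤ 1∕4`: `∣cgf X μ h − cgf X μ (−h) − 2h·μ[X]∣ ≤ 6·h³` (the quadratic terms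
  `h²·μ[X²]∕2` CANCEL in the symmetric difference; what is left is third order: `exp` to order 3 with Mathlib's remainder `(2∕9)∣x∣³`, `log(1+u)` to order 2 with
  remainder `∣u∣³∕(1−∣u∣)`, `∣u∣ ≤ (8∕7)h ≤ 2∕7`).
* §2 `genFun_schemeZ_symmetric`: the same for node U6's generating functions of every string of a torus scheme (`β_K ≥ 0`, measurable observables bounded by `1`):
  `∣genFun (schemeZ S os) K h − genFun (schemeZ S os) K (−h) − 2h·S.expectAt K os∣ ≤ 6·h³` on `0 < h ≤ 1∕4` — the hypothesis `hsym` of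
  `DirectPairingApexEffective.expect_rate_of_symmetric` with `M = 3`, for EVERY `K`.
* §3 `expectAt_rate_of_king_symmetric`: King's per-string socket (EXACTLY the datum of `DirectPairingApex.stringwiseGenFunCauchy_of_king` ∕
  `DirectPairingApexEffective.expectAt_rate_of_king`) ⇒ the expectations converge to some `E` with `∣S.expectAt (K₀+K) os − E∣ ≤ 2·vol·Δ_K∕h + 6·h²` for every
  `h ∈ ]0, min(l₀, 1∕4)]`, hence (`expectAt_rate_of_king_symmetric_opt`) `≤ 18·h₀²` at `h₀³ = vol·Δ_K∕6`, i.e. `18·(vol·Δ_K∕6)^{2∕3} ≈ 5.45·(vol·Δ_K)^{2∕3}`, as soon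
  as `h₀ ≤ min(l₀, 1∕4)` — against C45 (a)'s `2·(vol·Δ_K)^{1∕2}`: the exponent `2∕3` beats `1∕2` for `vol·Δ_K < (2∕5.45)⁶ ≈ 2.4·10⁻³`.

VERDICT FOR THE ROW (census C45 (b)).  The square-root loss of C45 (a) is sharp in the CONVEX currency but is NOT the programme's loss at the apex: Bałaban-type
data (bounded block observables) satisfy the third-order symmetric bound for free, so the Wilson-loop expectations inherit the exponent `2∕3` of the King
route's generating-function rate — geometric ratio `r` per step ⇒ `r^{2∕3}`; polynomial exponent `q` ⇒ `2q∕3`; `K(ε)` ⇒ `K((ε∕18)^{3∕2}·6∕vol)`.  (Central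
differences of every order `k` would give `1 − 1∕k` — prose.)  NOTHING new is owed by the E-side; CLASSIFICATION OF NE9 UNCHANGED: WORK-bound (W1; instance 0∕1).

HONEST FRAMING: bookkeeping for rung (B)+1 on ONE FIXED finite four-torus; §1 is an elementary fact about bounded random variables, §§2–3 junctions with the tree's
apex vocabulary under King's matching SHAPE — the cell's located estimate, NOT in print for Bałaban's d = 4 procedure; every bound is a MODEL-level formula, not
a certified constant of Bałaban's; NE9 NOT PRINTED ∕ NOT PROVED; spine PROVED 0∕9 unchanged; instance 0∕1; NOT UV stability, NOT the continuum limit, NOT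
infinite volume, NOT a mass gap, NOT Clay.  HONEST DEPENDENCY: continuum YM on T⁴ ⇐ BetaPertH ∧ nine spine estimates (0∕9 proved); BetaPertH ⇐ (D1) ∧ (D4) ∧ CAP+tail.

References (TYPES only): [King1986] = C. King, Commun. Math. Phys. **102** (1986) 649–677, Thm 3.4 (3.9) p. 656, (3.13) p. 657; [JaffeWittenClay2006] §6.5 p. 11.
-/

namespace Summit.QuantumFields.BalabanUV.T4Continuum.NE9.DirectPairingApexSymmetric

open scoped BigOperators
open Finset Filter Topology MeasureTheory ProbabilityTheory
open Literature.MathematicalPhysics.QuantumFieldTheory.Balaban1983to89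
open T4CauchySum (genFun)
open Missing (TorusScheme)
open Summit.QuantumFields.BalabanUV.T4Continuum.NE9.DirectPairingCauchy (abs_genFun_add_sub_le)
open Summit.QuantumFields.BalabanUV.T4Continuum.NE9.DirectPairingApexEffective
  (abs_sub_le_of_symmetric cauchySeq_of_pairBound limit_le_of_pairBound)

/-! ## §1 The third-order symmetric bound for the cumulant generating function of a bounded variable -/

section Generic

variable {Ω : Type*} {mΩ : MeasurableSpace Ω} {X : Ω → ℝ} {μ : Measure Ω}

/-- `∣E[e^{tX}] − (1 + t·E[X] + t²·E[X²]∕2)∣ ≤ (2∕9)·∣t∣³` for `∣X∣ ≤ 1` a.e. and `∣t∣ ≤ 1` (Mathlib's `Real.exp_bound` to order 3, integrated). [folklore] -/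
theorem abs_mgf_sub_taylor_two_le [IsProbabilityMeasure μ] (hX : AEMeasurable X μ) (hB : ∀ᵐ ω ∂μ, |X ω| ≤ 1)
    {t : ℝ} (ht : |t| ≤ 1) :
    |mgf X μ t - (1 + t * μ[X] + t ^ 2 * μ[fun ω => X ω ^ 2] / 2)| ≤ 2 / 9 * |t| ^ 3 := by
  have hXIcc : ∀ᵐ ω ∂μ, X ω ∈ Set.Icc (-1 : ℝ) 1 := hB.mono fun ω h => abs_le.mp h
  have hXi : Integrable X μ := Integrable.of_mem_Icc (-1) 1 hX hXIcc
  have hX2i : Integrable (fun ω => X ω ^ 2) μ := by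
    refine Integrable.of_mem_Icc 0 1 (hX.pow_const 2) (hB.mono fun ω h => ⟨sq_nonneg _, ?_⟩)
    have := abs_le.mp h
    nlinarith
  have hint : Integrable (fun ω => Real.exp (t * X ω)) μ := integrable_exp_mul_of_mem_Icc hX hXIcc
  have hpoly : Integrable (fun ω => 1 + t * X ω + t ^ 2 * X ω ^ 2 / 2) μ :=
    ((integrable_const _).add (hXi.const_mul t)).add ((hX2i.const_mul (t ^ 2)).div_const 2)
  -- pointwise Taylor bound
  have hpt : ∀ᵐ ω ∂μ, ‖Real.exp (t * X ω) - (1 + t * X ω + t ^ 2 * X ω ^ 2 / 2)‖ ≤ 2 / 9 * |t| ^ 3 := hB.mono fun ω hω => by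
    have hx : |t * X ω| ≤ 1 := by
      rw [abs_mul]
      calc |t| * |X ω| ≤ 1 * 1 := mul_le_mul ht hω (abs_nonneg _) zero_le_one
        _ = 1 := one_mul 1
    have hb := Real.exp_bound hx (n := 3) (by norm_num)
    have hsum : ∑ m ∈ range 3, (t * X ω) ^ m / (m.factorial : ℝ) = 1 + t * X ω + t ^ 2 * X ω ^ 2 / 2 := by
      simp only [sum_range_succ, sum_range_zero, Nat.factorial]
      push_cast
      ring
    rw [hsum] at hb
    rw [Real.norm_eq_abs]
    refine hb.trans ?_
    have h3 : |t * X ω| ^ 3 ≤ |t| ^ 3 := by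
      rw [abs_mul]
      calc (|t| * |X ω|) ^ 3 ≤ (|t| * 1) ^ 3 := by gcongr
        _ = |t| ^ 3 := by rw [mul_one]
    have hc : ((Nat.succ 3 : ℕ) : ℝ) / ((Nat.factorial 3 : ℕ) * (3 : ℕ)) = 2 / 9 := by norm_num [Nat.factorial]
    rw [hc] at *
    nlinarith [abs_nonneg (t * X ω)]
  have hI := norm_integral_le_of_norm_le_const hpt
  rw [probReal_univ, mul_one, integral_sub hint hpoly, Real.norm_eq_abs] at hI
  have hlin : ∫ ω, (1 + t * X ω + t ^ 2 * X ω ^ 2 / 2) ∂μ = 1 + t * μ[X] + t ^ 2 * μ[fun ω => X ω ^ 2] / 2 := by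
    have i1 : Integrable (fun ω => (1 : ℝ) + t * X ω) μ := (integrable_const _).add (hXi.const_mul t)
    have i2 : Integrable (fun ω => t ^ 2 * X ω ^ 2 / 2) μ := (hX2i.const_mul (t ^ 2)).div_const 2
    have s1 : ∫ ω, (1 + t * X ω + t ^ 2 * X ω ^ 2 / 2) ∂μ = (∫ ω, (1 + t * X ω) ∂μ) + ∫ ω, t ^ 2 * X ω ^ 2 / 2 ∂μ :=
      integral_add i1 i2
    have s2 : ∫ ω, (1 + t * X ω) ∂μ = (∫ _ω, (1 : ℝ) ∂μ) + ∫ ω, t * X ω ∂μ := integral_add (integrable_const _) (hXi.const_mul t)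
    have s3 : ∫ ω, t * X ω ∂μ = t * ∫ ω, X ω ∂μ := integral_const_mul t X
    have s4 : ∫ ω, t ^ 2 * X ω ^ 2 / 2 ∂μ = t ^ 2 * (∫ ω, X ω ^ 2 ∂μ) / 2 := by
      rw [integral_div, integral_const_mul]
    rw [s1, s2, s3, s4]
    simp only [integral_const, probReal_univ, one_smul]
  rw [hlin] at hI
  exact hI

/-- **THE SYMMETRIC THIRD-ORDER BOUND.**  For a probability measure, `∣X∣ ≤ 1` a.e. and `0 < h ≤ 1∕4`:
`∣cgf X μ h − cgf X μ (−h) − 2h·μ[X]∣ ≤ 6·h³` — the quadratic terms cancel in the symmetric difference (`M = 3` in the currency of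
`DirectPairingApexEffective.abs_sub_le_of_symmetric`). [folklore] -/
theorem abs_cgf_symm_sub_le [IsProbabilityMeasure μ] (hX : AEMeasurable X μ) (hB : ∀ᵐ ω ∂μ, |X ω| ≤ 1)
    {h : ℝ} (hh : 0 < h) (hh4 : h ≤ 1 / 4) :
    |cgf X μ h - cgf X μ (-h) - 2 * h * μ[X]| ≤ 6 * h ^ 3 := by
  have hXIcc : ∀ᵐ ω ∂μ, X ω ∈ Set.Icc (-1 : ℝ) 1 := hB.mono fun ω h => abs_le.mp h
  have hint : ∀ t : ℝ, Integrable (fun ω => Real.exp (t * X ω)) μ := fun t => integrable_exp_mul_of_mem_Icc hX hXIcc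
  set m : ℝ := μ[X] with hm
  set a : ℝ := μ[fun ω => X ω ^ 2] with ha
  -- the first two moments are bounded by `1`
  have hm1 : |m| ≤ 1 := by
    have := norm_integral_le_of_norm_le_const (f := X) (C := 1) (hB.mono fun ω h => by rwa [Real.norm_eq_abs])
    rwa [probReal_univ, mul_one, Real.norm_eq_abs] at this
  have ha0 : 0 ≤ a := integral_nonneg fun ω => sq_nonneg _
  have ha1 : a ≤ 1 := by
    have := norm_integral_le_of_norm_le_const (f := fun ω => X ω ^ 2) (C := 1) (hB.mono fun ω h => by
      rw [Real.norm_eq_abs, abs_of_nonneg (sq_nonneg _)]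
      have := abs_le.mp h
      nlinarith)
    rw [probReal_univ, mul_one, Real.norm_eq_abs] at this
    exact (le_abs_self _).trans this
  have hh1 : |h| ≤ 1 := by rw [abs_of_pos hh]; linarith
  have hh1' : |(-h)| ≤ 1 := by rwa [abs_neg]
  -- `u τ = mgf τ − 1` and its Taylor remainder `R τ`
  have hR : ∀ τ : ℝ, |τ| ≤ 1 → |mgf X μ τ - 1 - (τ * m + τ ^ 2 * a / 2)| ≤ 2 / 9 * |τ| ^ 3 := by
    intro τ hτ
    have := abs_mgf_sub_taylor_two_le hX hB hτ
    have e : mgf X μ τ - 1 - (τ * m + τ ^ 2 * a / 2) = mgf X μ τ - (1 + τ * m + τ ^ 2 * a / 2) := by ring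
    rwa [e]
  have hRp := hR h hh1
  have hRm := hR (-h) hh1'
  rw [abs_of_pos hh] at hRp
  rw [abs_neg, abs_of_pos hh, show (-h) ^ 2 * a / 2 = h ^ 2 * a / 2 by ring] at hRm
  set up : ℝ := mgf X μ h - 1 with hup
  set um : ℝ := mgf X μ (-h) - 1 with hum
  -- size of `u`: `∣u∣ ≤ h + h²∕2 + (2∕9)h³ ≤ (8∕7)h ≤ 2∕7`
  have hh2 : h ^ 2 ≤ h / 4 := by nlinarith
  have hh3 : h ^ 3 ≤ h / 16 := by nlinarith
  have hma : |h * m| ≤ h := by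
    rw [abs_mul, abs_of_pos hh]
    exact (mul_le_mul_of_nonneg_left hm1 hh.le).trans_eq (mul_one h)
  have hqa : |h ^ 2 * a / 2| ≤ h ^ 2 / 2 := by
    rw [abs_of_nonneg (by positivity)]
    nlinarith
  -- size of `u`: `∣u∣ ≤ ∣P∣ + (2∕9)h³ ≤ h + h²∕2 + (2∕9)h³ ≤ (8∕7)h ≤ 2∕7`
  have hu_le : ∀ u P : ℝ, |u - P| ≤ 2 / 9 * h ^ 3 → |P| ≤ h + h ^ 2 / 2 → |u| ≤ 8 / 7 * h := by
    intro u P h1 h2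
    have h3 := abs_sub_abs_le_abs_sub u P
    linarith
  have hup_le : |up| ≤ 8 / 7 * h := by
    refine hu_le up _ hRp ((abs_add_le _ _).trans ?_)
    linarith
  have hum_le : |um| ≤ 8 / 7 * h := by
    refine hu_le um _ hRm ((abs_add_le _ _).trans ?_)
    have e1 : |-h * m| = |h * m| := by rw [neg_mul, abs_neg]
    rw [e1]
    linarith
  have hU : (8 : ℝ) / 7 * h ≤ 2 / 7 := by linarith
  have hup_lt : |up| < 1 := by linarith
  have hum_lt : |um| < 1 := by linarith
  -- `log(1 + u) = u − u²∕2 + v`, `∣v∣ ≤ ∣u∣³∕(1 − ∣u∣) ≤ ((8∕7)h)³∕(1 − 2∕7)`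
  have hlog : ∀ u : ℝ, |u| ≤ 8 / 7 * h → |Real.log (1 + u) - u + u ^ 2 / 2| ≤ (8 / 7 * h) ^ 3 / (1 - 2 / 7) := by
    intro u hu
    have hu1 : |u| < 1 := by linarith
    have hx : |(-u)| < 1 := by rwa [abs_neg]
    have hb := Real.abs_log_sub_add_sum_range_le hx 2
    have hs : ∑ i ∈ range 2, (-u) ^ (i + 1) / ((i : ℝ) + 1) = -u + u ^ 2 / 2 := by
      simp only [sum_range_succ, sum_range_zero, zero_add, Nat.cast_zero, Nat.cast_one, pow_one]
      ring
    rw [hs, sub_neg_eq_add, abs_neg] at hb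
    have e : Real.log (1 + u) - u + u ^ 2 / 2 = -u + u ^ 2 / 2 + Real.log (1 + u) := by ring
    rw [e]
    refine hb.trans ?_
    have hden : 0 < 1 - |u| := by linarith
    calc |u| ^ 3 / (1 - |u|) ≤ (8 / 7 * h) ^ 3 / (1 - |u|) := by gcongr
      _ ≤ (8 / 7 * h) ^ 3 / (1 - 2 / 7) := by
        apply div_le_div_of_nonneg_left (by positivity) (by norm_num)
        linarith
  have hvp := hlog up hup_le
  have hvm := hlog um hum_le
  -- assemble: `cgf τ = log (1 + u τ)`
  have hcp : cgf X μ h = Real.log (1 + up) := by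
    have e : 1 + up = mgf X μ h := by rw [hup]; ring
    rw [e]
    rfl
  have hcm : cgf X μ (-h) = Real.log (1 + um) := by
    have e : 1 + um = mgf X μ (-h) := by rw [hum]; ring
    rw [e]
    rfl
  rw [hcp, hcm]
  -- the differences of the `u`'s
  have hdiff : |up - um - 2 * h * m| ≤ 4 / 9 * h ^ 3 := by
    have e : up - um - 2 * h * m = (up - (h * m + h ^ 2 * a / 2)) - (um - (-h * m + h ^ 2 * a / 2)) := by ring
    rw [e]
    refine (abs_sub _ _).trans ?_
    linarith
  have hsumu : |up + um| ≤ h ^ 2 + 4 / 9 * h ^ 3 := by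
    have e : up + um = (up - (h * m + h ^ 2 * a / 2)) + (um - (-h * m + h ^ 2 * a / 2)) + h ^ 2 * a := by ring
    rw [e]
    refine (abs_add_le _ _).trans ?_
    refine (add_le_add (abs_add_le _ _) le_rfl).trans ?_
    have : |h ^ 2 * a| ≤ h ^ 2 := by
      rw [abs_of_nonneg (by positivity)]
      exact (mul_le_mul_of_nonneg_left ha1 (by positivity)).trans_eq (mul_one _)
    linarith
  have hdiffu : |up - um| ≤ 2 * h + 4 / 9 * h ^ 3 := by
    have e : up - um = (up - um - 2 * h * m) + 2 * h * m := by ring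
    rw [e]
    refine (abs_add_le _ _).trans ?_
    have : |2 * h * m| ≤ 2 * h := by
      rw [abs_mul, abs_of_pos (by positivity : (0 : ℝ) < 2 * h)]
      exact (mul_le_mul_of_nonneg_left hm1 (by positivity)).trans_eq (mul_one _)
    linarith
  have hsq : |(up ^ 2 - um ^ 2) / 2| ≤ 8 / 7 * h ^ 3 := by
    rw [abs_div, abs_two, show up ^ 2 - um ^ 2 = (up - um) * (up + um) by ring, abs_mul]
    have hprod := mul_le_mul hdiffu hsumu (abs_nonneg _) (by positivity)
    have hlin' : 8 / 9 * h + 4 / 9 * h ^ 2 + 16 / 81 * h ^ 3 ≤ 2 / 7 := by linarith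
    have hnum : (2 * h + 4 / 9 * h ^ 3) * (h ^ 2 + 4 / 9 * h ^ 3) ≤ 16 / 7 * h ^ 3 := by
      have h3pos : 0 < h ^ 3 := pow_pos hh 3
      have e : (2 * h + 4 / 9 * h ^ 3) * (h ^ 2 + 4 / 9 * h ^ 3) = h ^ 3 * (2 + (8 / 9 * h + 4 / 9 * h ^ 2 + 16 / 81 * h ^ 3)) := by
        ring
      rw [e]
      nlinarith [mul_le_mul_of_nonneg_left hlin' h3pos.le]
    linarith
  -- final assembly
  have e : Real.log (1 + up) - Real.log (1 + um) - 2 * h * m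
      = (up - um - 2 * h * m) - (up ^ 2 - um ^ 2) / 2
        + ((Real.log (1 + up) - up + up ^ 2 / 2) - (Real.log (1 + um) - um + um ^ 2 / 2)) := by ring
  rw [e]
  have hv : |(Real.log (1 + up) - up + up ^ 2 / 2) - (Real.log (1 + um) - um + um ^ 2 / 2)| ≤ 2 * ((8 / 7 * h) ^ 3 / (1 - 2 / 7)) :=
    (abs_sub _ _).trans (by linarith)
  have hvnum : 2 * ((8 / 7 * h) ^ 3 / (1 - 2 / 7)) ≤ 42 / 10 * h ^ 3 := by
    have e : 2 * ((8 / 7 * h) ^ 3 / (1 - 2 / 7)) = 2 * (8 / 7) ^ 3 / (5 / 7) * h ^ 3 := by ring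
    rw [e]
    exact mul_le_mul_of_nonneg_right (by norm_num) (pow_pos hh 3).le
  calc |(up - um - 2 * h * m) - (up ^ 2 - um ^ 2) / 2
        + ((Real.log (1 + up) - up + up ^ 2 / 2) - (Real.log (1 + um) - um + um ^ 2 / 2))|
      ≤ |(up - um - 2 * h * m) - (up ^ 2 - um ^ 2) / 2|
        + |(Real.log (1 + up) - up + up ^ 2 / 2) - (Real.log (1 + um) - um + um ^ 2 / 2)| := abs_add_le _ _
    _ ≤ (|up - um - 2 * h * m| + |(up ^ 2 - um ^ 2) / 2|) + 2 * ((8 / 7 * h) ^ 3 / (1 - 2 / 7)) :=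
        add_le_add (abs_sub _ _) hv
    _ ≤ 6 * h ^ 3 := by linarith [hdiff, hsq, hvnum, pow_pos hh 3]

end Generic

/-! ## §2 Scheme level: node U6's generating functions obey the symmetric bound, for every string and step -/

section Scheme

variable {G : Type*} [GaugeGroup G] [MeasurableSpace G] [RegularGaugeGroup G] [HaarData G] {O : Type*}

/-- **THE SYMMETRIC BOUND FOR EVERY STRING OF A TORUS SCHEME** (`β_K ≥ 0`, measurable observables bounded by `1`): for `0 < h ≤ 1∕4`,
`∣genFun (schemeZ S os) K h − genFun (schemeZ S os) K (−h) − 2h·S.expectAt K os∣ ≤ 6·h³` — §1 for `prodObs S K os` under `gibbsMeasure (S.P K) (S.β K)`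
through `T4GenFunBounds.genFun_schemeZ_eq_cgf` ∕ `expectAt_eq_integral_gibbs`. [folklore] -/
theorem genFun_schemeZ_symmetric (S : TorusScheme G O) (hβ : ∀ K, 0 ≤ S.β K)
    (hm : ∀ K o, Measurable (S.obs K o)) (h1 : ∀ K o U, |S.obs K o U| ≤ 1) (K : ℕ) (os : List O)
    {h : ℝ} (hh : 0 < h) (hh4 : h ≤ 1 / 4) :
    |genFun (T4GenFunBounds.schemeZ S os) K h - genFun (T4GenFunBounds.schemeZ S os) K (-h) - 2 * h * S.expectAt K os| ≤ 6 * h ^ 3 := by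
  haveI : IsProbabilityMeasure (T4GenFunBounds.gibbsMeasure (G := G) (S.P K) (S.β K)) :=
    T4GenFunBounds.isProbabilityMeasure_gibbsMeasure (S.P K) (hβ K)
  rw [T4GenFunBounds.genFun_schemeZ_eq_cgf S hβ hm h1 K os h, T4GenFunBounds.genFun_schemeZ_eq_cgf S hβ hm h1 K os (-h),
    T4GenFunBounds.expectAt_eq_integral_gibbs S hβ K os]
  exact abs_cgf_symm_sub_le (T4GenFunBounds.measurable_prodObs S hm K os).aemeasurable
    (Eventually.of_forall (T4GenFunBounds.abs_prodObs_le_one S h1 K os)) hh hh4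

/-! ## §3 King's per-string socket ⇒ the exponent `2∕3` for the Wilson-loop expectations -/

/-- **THE RATE AT THE APEX, EXPONENT `2∕3`.**  Under King's per-string socket (EXACTLY the datum of `DirectPairingApexEffective.expectAt_rate_of_king`:
`l₀ > 0`, `vol`, offset `K₀`, remainders `Δ_K → 0`, `∣log Z_{K₀+K+n}(t) − log Z_{K₀+K}(t) − c∣ ≤ vol·Δ_K` on `∣t∣ ≤ l₀`), the joint expectations converge to
some `E` with `∣S.expectAt (K₀+K) os − E∣ ≤ 2·vol·Δ_K∕h + 6·h²` for every `h ∈ ]0, min(l₀, 1∕4)]` (§2 + `DirectPairingCauchy.abs_genFun_add_sub_le` +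
`DirectPairingApexEffective.cauchySeq_of_pairBound` ∕ `limit_le_of_pairBound`).  CONDITIONAL kernel theorem on a hypothesis SHAPE (King's matching).
[cite: King1986, Thm 3.4 (3.9) p. 656, p. 657] [folklore] -/
theorem expectAt_rate_of_king_symmetric (S : TorusScheme G O) (hβ : ∀ K, 0 ≤ S.β K)
    (hm : ∀ K o, Measurable (S.obs K o)) (h1 : ∀ K o U, |S.obs K o U| ≤ 1) (os : List O)
    {l₀ vol : ℝ} {K₀ : ℕ} {Δ : ℕ → ℝ} (hl₀ : 0 < l₀) (hΔ : Tendsto Δ atTop (𝓝 0))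
    (hU5 : ∀ K n : ℕ, ∃ c : ℝ, ∀ t : ℝ, |t| ≤ l₀ →
      |Real.log (T4GenFunBounds.schemeZ S os (K₀ + (K + n)) t) -
          Real.log (T4GenFunBounds.schemeZ S os (K₀ + K) t) - c| ≤ vol * Δ K) :
    ∃ E : ℝ, Tendsto (fun K => S.expectAt K os) atTop (𝓝 E) ∧
      ∀ K h, 0 < h → h ≤ min l₀ (1 / 4) → |S.expectAt (K₀ + K) os - E| ≤ 2 * (vol * Δ K) / h + 6 * h ^ 2 := by
  set l₁ : ℝ := min l₀ (1 / 4) with hl₁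
  have hl₁pos : 0 < l₁ := lt_min hl₀ (by norm_num)
  have hb : ∀ K n h, 0 < h → h ≤ l₁ → |S.expectAt (K₀ + (K + n)) os - S.expectAt (K₀ + K) os| ≤ 2 * (vol * Δ K) / h + 2 * 3 * h ^ 2 := by
    intro K n h hh hhl
    have hh4 : h ≤ 1 / 4 := hhl.trans (min_le_right _ _)
    have hhl₀ : |h| ≤ l₀ := by rw [abs_of_pos hh]; exact hhl.trans (min_le_left _ _)
    have hhl₀' : |(-h)| ≤ l₀ := by rwa [abs_neg]
    have hs1 := genFun_schemeZ_symmetric S hβ hm h1 (K₀ + (K + n)) os hh hh4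
    have hs0 := genFun_schemeZ_symmetric S hβ hm h1 (K₀ + K) os hh hh4
    have hc1 := abs_genFun_add_sub_le (Z := fun K => T4GenFunBounds.schemeZ S os (K₀ + K)) hU5 hl₀.le K n hhl₀
    have hc2 := abs_genFun_add_sub_le (Z := fun K => T4GenFunBounds.schemeZ S os (K₀ + K)) hU5 hl₀.le K n hhl₀'
    simp only [genFun] at hs1 hs0 hc1 hc2
    have e3 : (2 : ℝ) * 3 * h ^ 3 = 6 * h ^ 3 := by ring
    refine abs_sub_le_of_symmetric (f := fun t => Real.log (T4GenFunBounds.schemeZ S os (K₀ + (K + n)) t) -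
        Real.log (T4GenFunBounds.schemeZ S os (K₀ + (K + n)) 0))
      (f' := fun t => Real.log (T4GenFunBounds.schemeZ S os (K₀ + K) t) - Real.log (T4GenFunBounds.schemeZ S os (K₀ + K) 0))
      hh ?_ ?_ hc1 hc2
    · rw [e3]; exact hs1
    · rw [e3]; exact hs0
  have hρ : Tendsto (fun K => 2 * (vol * Δ K)) atTop (𝓝 0) := by simpa using (hΔ.const_mul vol).const_mul 2
  have hφ : Tendsto (fun h : ℝ => 2 * 3 * h ^ 2) (𝓝[>] 0) (𝓝 0) := by
    have h1' : Tendsto (fun h : ℝ => 2 * 3 * h ^ 2) (𝓝 0) (𝓝 (2 * 3 * 0 ^ 2)) :=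
      (continuous_const.mul (continuous_pow 2)).tendsto 0
    rw [zero_pow two_ne_zero, mul_zero] at h1'
    exact tendsto_nhdsWithin_of_tendsto_nhds h1'
  have hb' : ∀ K n h, 0 < h → h ≤ l₁ →
      |(fun K => S.expectAt (K₀ + K) os) (K + n) - (fun K => S.expectAt (K₀ + K) os) K| ≤
        (fun K => 2 * (vol * Δ K)) K / h + 2 * 3 * h ^ 2 := by
    intro K n h hh hhl
    simpa only [add_assoc] using hb K n h hh hhl
  obtain ⟨E, hE⟩ := cauchySeq_tendsto_of_complete
    (cauchySeq_of_pairBound (e := fun K => S.expectAt (K₀ + K) os) (ρ := fun K => 2 * (vol * Δ K)) hl₁pos hφ hb' hρ)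
  refine ⟨E, ?_, fun K h hh hhl => ?_⟩
  · have hE' : Tendsto (fun K => S.expectAt (K + K₀) os) atTop (𝓝 E) := hE.congr fun K => by simp only [add_comm]
    exact (tendsto_add_atTop_iff_nat K₀).1 hE'
  · have := limit_le_of_pairBound (e := fun K => S.expectAt (K₀ + K) os) (ρ := fun K => 2 * (vol * Δ K)) hb' hE K hh hhl
    have e6 : (2 : ℝ) * 3 * h ^ 2 = 6 * h ^ 2 := by ring
    simpa only [e6] using this

/-- … **at the optimal point**: with `h₀ = (vol·Δ_K∕6)^{1∕3} ≤ min(l₀, 1∕4)` (and `vol·Δ_K > 0`), `∣S.expectAt (K₀+K) os − E∣ ≤ 18·h₀² = 18·(vol·Δ_K∕6)^{2∕3}`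
— the exponent `2∕3` of node U6's rate, against `2·(vol·Δ_K)^{1∕2}` in the convex currency (`DirectPairingApexEffective.expectAt_rate_of_king`). [folklore] -/
theorem expectAt_rate_of_king_symmetric_opt (S : TorusScheme G O) (hβ : ∀ K, 0 ≤ S.β K)
    (hm : ∀ K o, Measurable (S.obs K o)) (h1 : ∀ K o U, |S.obs K o U| ≤ 1) (os : List O)
    {l₀ vol : ℝ} {K₀ : ℕ} {Δ : ℕ → ℝ} (hl₀ : 0 < l₀) (hΔ : Tendsto Δ atTop (𝓝 0))
    (hU5 : ∀ K n : ℕ, ∃ c : ℝ, ∀ t : ℝ, |t| ≤ l₀ →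
      |Real.log (T4GenFunBounds.schemeZ S os (K₀ + (K + n)) t) -
          Real.log (T4GenFunBounds.schemeZ S os (K₀ + K) t) - c| ≤ vol * Δ K) :
    ∃ E : ℝ, Tendsto (fun K => S.expectAt K os) atTop (𝓝 E) ∧
      ∀ K, 0 < vol * Δ K → (vol * Δ K / 6) ^ ((3 : ℕ) : ℝ)⁻¹ ≤ min l₀ (1 / 4) →
        |S.expectAt (K₀ + K) os - E| ≤ 18 * ((vol * Δ K / 6) ^ ((3 : ℕ) : ℝ)⁻¹) ^ 2 := by
  obtain ⟨E, hE, hb⟩ := expectAt_rate_of_king_symmetric S hβ hm h1 os hl₀ hΔ hU5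
  refine ⟨E, hE, fun K hpos hwin => ?_⟩
  set h₀ : ℝ := (vol * Δ K / 6) ^ ((3 : ℕ) : ℝ)⁻¹ with hh₀
  have hq : 0 < vol * Δ K / 6 := by positivity
  have hh₀pos : 0 < h₀ := Real.rpow_pos_of_pos hq _
  have hcube : h₀ ^ 3 = vol * Δ K / 6 := Real.rpow_inv_natCast_pow hq.le (by norm_num)
  have key := hb K h₀ hh₀pos hwin
  have e1 : 2 * (vol * Δ K) / h₀ = 12 * h₀ ^ 2 := by
    rw [div_eq_iff hh₀pos.ne']
    have : vol * Δ K = 6 * h₀ ^ 3 := by rw [hcube]; ring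
    rw [this]
    ring
  rw [e1] at key
  linarith

end Scheme

end Summit.QuantumFields.BalabanUV.T4Continuum.NE9.DirectPairingApexSymmetric
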